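import Mathlib
import Summits.Ventures.HodgeRepro2.T5CornerSmooth

/-!
# Smoothness of `Hom_{G₁}(π₁, S[π₁])` (the second factor of MVW III.3)

Blind cell `pub-hodge-repro2`, seat p8 (gen 6), Tier-5 kernel support for the N3 record
(MVW chap. 2 III.3 / III.5; CHECK-N3 §7 row N3.10.3).  `T5IsotypicHom` (p392230) realises MVW's
`S[π₁] ≅ π₁ ⊗ V₂′` with `V₂′ = Hom_{G₁}(π₁, S[π₁])` and `G₂` acting by post-composition, and
lists «smoothness of `V₂′`» among what the prose supplies.  This file records that smoothness in
kernel form, on the Hecke-algebra side of `T5CornerSmooth` (p393220): for a module `V` with two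
commuting actions (of `R = H(G₁)⁺` and `R₂ = H(G₂)⁺`), smooth for a directed family of idempotents
`e i ∈ R₂` (`e_{K_i}`), and a FINITELY GENERATED `R`-module `N` (an irreducible `π₁` is cyclic),
the `R₂`-module `Hom_R(N, V)` (post-composition) is smooth for the same family:

* `smul_eq_of_le` — `e j • (e i • x) = e i • x` for `i ≤ j` (the family is directed);
* `isSmoothModule_hom` — **smoothness of `Hom_R(N, V)`**: a map `f` is determined by its values
  on a finite generating set of `N`; each value is fixed by some `e i`; a common upper bound `k`
  fixes all of them, and `e k • f = f` on the generators, hence everywhere (`LinearMap.ext_on`);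
* `isSmoothModule_hom_of_span_singleton` / `isSmoothModule_hom_of_isSimpleModule` — the cyclic
  and the simple case (`IsSimpleModule.span_singleton_eq_top`).

In the record: `V = S[π₁]` (smooth for `G₂` because `S` is), `N = π₁` (irreducible, hence cyclic),
`V₂′ = Hom_{G₁}(π₁, S[π₁])` is a smooth representation of `G₂`.  What stays prose: smooth
representations = non-degenerate modules over the unitalised Hecke algebra, `e_K • π = π^K`.
Nothing arithmetic is asserted.

README §8(d): uses an L-value-free non-vanishing device: NO.
-/

namespace Summit.Ventures.HodgeRepro2.T5HomSmooth

open Summit.Ventures.HodgeRepro2.T5CornerSmooth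

section Directed

variable {R₂ : Type*} [Ring R₂] {ι : Type*} [Preorder ι] (e : ι → R₂)
  (hmono : ∀ i j, i ≤ j → e j * e i = e i)
  {M : Type*} [AddCommGroup M] [Module R₂ M]

include hmono in
/-- For a directed family of idempotents (`e j * e i = e i` for `i ≤ j`), a vector fixed by `e i`
is fixed by every `e j` with `i ≤ j`. -/
theorem smul_eq_of_le {i j : ι} (hij : i ≤ j) {x : M} (hx : e i • x = x) : e j • x = x := by
  conv_lhs => rw [← hx]
  rw [← mul_smul, hmono i j hij, hx]

end Directed

section Hom

variable {R R₂ : Type*} [Ring R] [Ring R₂] {ι : Type*} [Preorder ι] [Nonempty ι]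
  [IsDirectedOrder ι] (e : ι → R₂) (hmono : ∀ i j, i ≤ j → e j * e i = e i)
  {N : Type*} [AddCommGroup N] [Module R N]
  {V : Type*} [AddCommGroup V] [Module R V] [Module R₂ V] [SMulCommClass R R₂ V]

include hmono in
/-- **Smoothness of `Hom_R(N, V)`.** If `V` is smooth for a directed family of idempotents of
`R₂` (acting on `V` commuting with `R`) and `N` is a finitely generated `R`-module, then
`Hom_R(N, V)` with the post-composition `R₂`-action is smooth for the same family. -/
theorem isSmoothModule_hom [Module.Finite R N] (hV : IsSmoothModule e (M := V)) :
    IsSmoothModule e (M := N →ₗ[R] V) := by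
  intro f
  obtain ⟨s, hs⟩ : (⊤ : Submodule R N).FG := Module.Finite.fg_top
  -- an index fixing `f n` for each generator `n ∈ s`
  classical
  choose idx hidx using fun n : N => hV (f n)
  obtain ⟨k, hk⟩ := (s.image idx).exists_le
  refine ⟨k, ?_⟩
  refine LinearMap.ext_on hs ?_
  intro n hn
  rw [LinearMap.smul_apply]
  exact smul_eq_of_le e hmono (hk (idx n) (Finset.mem_image_of_mem idx hn)) (hidx n)

include hmono in
/-- The cyclic case: `N` generated by one vector `n₀`. -/
theorem isSmoothModule_hom_of_span_singleton (n₀ : N) (hn₀ : Submodule.span R {n₀} = ⊤)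
    (hV : IsSmoothModule e (M := V)) : IsSmoothModule e (M := N →ₗ[R] V) := by
  haveI : Module.Finite R N := ⟨⟨{n₀}, by simpa using hn₀⟩⟩
  exact isSmoothModule_hom e hmono hV

include hmono in
/-- The simple case (an irreducible `π₁` is cyclic): for `N` a simple `R`-module, `Hom_R(N, V)` is
smooth whenever `V` is (`IsSimpleModule.span_singleton_eq_top`). -/
theorem isSmoothModule_hom_of_isSimpleModule [IsSimpleModule R N]
    (hV : IsSmoothModule e (M := V)) : IsSmoothModule e (M := N →ₗ[R] V) := by
  have : Nontrivial N := IsSimpleModule.nontrivial R N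
  obtain ⟨n₀, hn₀⟩ := exists_ne (0 : N)
  exact isSmoothModule_hom_of_span_singleton e hmono n₀ (IsSimpleModule.span_singleton_eq_top R hn₀) hV

end Hom

end Summit.Ventures.HodgeRepro2.T5HomSmooth
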